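import Summits.QuantumFields.YangMills.Theorems.BalabanUVNodesN09LiftInvariance29JunkWitness
import Summits.QuantumFields.YangMills.Theorems.BalabanUVNodesN09TransportPositiveOnDomainOfFibredChart

/-!
# NODE N09 [B12] · KERNEL CERTIFICATE OF THE JUNK CORNER ON ROAD B: at the bare-choice record the GLOBAL support∕guard binders of g5's door
# `regular_of_loopSmall_chi29` (`ρ_k = 0` off a closed `K₀` lying in the loop α-guard, `α < δ_N`) are JOINTLY UNSATISFIABLE for the step-0 β-input — which is why
# g6 localised road B over `Ū⁻¹(domAlt_{k+1})`

Cell `pub-ymgap` (YM-PLAN Track A), DAG node N09 [Balaban1987RG1] (= [I]); width seat `pub-ymgap-dag-n09-w3` g6, FILE 8; count-neutral LOCATED NEGATIVE certificate keyed to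
K1⁹ `StabilityBRunRowsAtRecordR13SepCoPHV` = stmt-QuantumFields-27364 (`--kind proof --supports … --as helper`).  The crux is NOT touched (it does not mention these binders).

WHY.  This seat's g5 door (p633539) and its g6 FILE 1 localisation (p636180) differ exactly in WHERE the support∕guard∕boundedness∕continuity clauses are asked: on the
whole fine space (g5) or over `Ū⁻¹(D)` (g6).  The bus lines of this generation asserted that the global clauses «meet the junk corner» of the bare-choice record; THIS FILE
is the kernel proof, assembled from dag-n09-w2 g2–g3's junk witness (`…N09OneDefectAveraging`, `…N09LiftInvariance29JunkWitness`): the one-defect field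
`V = 1[b₀(c⋆) ↦ g]`, `dist1 g ≥ max(δ_N, 217·εreg)`, averages to the one-defect coarse field `1[c⋆ ↦ g]` (far plaquette ⇒ the level-1 problem of record is UNSOLVABLE there,
[B7] Prop 1), so the critical configuration of record over it is the junk default `1` (`critCfgOfRecord_of_not`), every non-distinguished fluctuation variable of `V` is
`dist1 1 = 0 < ε₂₉`, `χ^{(2.9)}_0(V) = 1` and the β-input `ρ_0(V) = exp[…] > 0` — while `V`'s non-central (0.4) loop at `c⋆` is `g⁻¹`, at distance `≥ δ_N > α` from `1`.
Hence NO set `K₀` can carry the support of `ρ_0` AND lie in the loop α-guard for any `α < δ_N` — the conjunction `hρK ∧ hK₀α ∧ hαδ` of g5's door is void at the record's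
step-0 β-input (every `K ≥ 1`, every transport `T`, every history): the door is VACUOUS there (A6), and the localisation of g6 FILE 1 is necessary, not cosmetic.

WHAT IS PROVED (theorems only; 0 def, 0 sorry; axioms standard).
* `critCfgOfRecord_zero_of_not` (`V^{(0)}(W) = 1` off the solvable set), `chiFix29OfRecord_zero_oneDefect_eq_one`, ★ `betaInput_chi29_zero_oneDefect_pos`,
  `exists_loopHol_oneDefect_ge` (a loop of `V` at `c⋆` at distance `≥ δ_N`).
* ★★★ `not_globalSupportGuard_betaInput_chi29_zero` — for `K ≥ 1`, `0 ≤ εreg`, `9εreg < δ_N`, `g` with `dist1 g ≥ max(δ_N, 217εreg)`, `0 < ε₁`, any `T`, any history, any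
  `α < δ_N` and ANY set `K₀`: `¬ ((∀ U, U ∉ K₀ → ρ_0 U = 0) ∧ (∀ U ∈ K₀, ∀ c i, dist1 (loopHol U c i) ≤ α))`.
* ★★ `not_globalSupportGuard_betaInput_chi29_zero_SU2` — on `SU(2)` with `g = exp(π e₀)` (`dist1 = 2`): the same for `217·εreg ≤ 2` — print's regime.

HONEST SCOPE ∕ FRAMING.  A kernel REFUTATION of the joint satisfiability of two displayed hypotheses of ONE helper theorem (this seat's own g5 door) at the record's
step-0 objects, from tree theorems BY NAME; it touches NO crux, NO door of record, NO count; the g6 LOCAL door (p636180) is unaffected (its clauses hold over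
`Ū⁻¹(domAlt_1)` by FILE 2 ∕ FILE 4); NOTHING of Bałaban's asserted; N09 NOT discharged; K0⁷ ∕ K1⁹ ∕ K2⁹ ∕ K3⁸ NOT closed; counts unmoved (typed 28∕28 · discharged 5∕28); R4 =
the conditional finite-𝕋⁴ rung `BalabanLadder.UV` only — NOT continuum ∕ ℝ⁴ ∕ OS; the Yang–Mills mass gap (Clay) is NOT proved by any of this.
-/

noncomputable section

open scoped Matrix.Norms.L2Operator
open Set Function MeasureTheory

namespace Summit.QuantumFields.YangMills.BalabanUVNodes.N09GlobalRoadBBindersJunkLocated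

open Literature.MathematicalPhysics.QuantumFieldTheory.Balaban1983to89
open Literature.MathematicalPhysics.QuantumFieldTheory.Balaban1983to89.Node00
open Literature.MathematicalPhysics.QuantumFieldTheory.Balaban1983to89.BlockAveraging (Idx loopHol)
open Literature.MathematicalPhysics.QuantumFieldTheory.Balaban1983to89.BlockAveragingHaarAC (centralBond IsCentral)
open Literature.MathematicalPhysics.QuantumFieldTheory.Balaban1983to89.ExpMeanLog (expMeanLogSU deltaSU deltaSU_pos)
open Literature.MathematicalPhysics.QuantumFieldTheory.Balaban1983to89.GaugeField (plaqHol)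
open Summit.QuantumFields.YangMills.BalabanUVNodes.N09OneDefectAveraging (avgFun_expMeanLogSU_update_one plaqHol_update_one
  loopHol_update_one_self_of_not_isCentral exists_not_isCentral)
open Summit.QuantumFields.YangMills.BalabanUVNodes.N09LiftInvariance29JunkWitness (not_ukExists_one_of_far_plaquette dir_lt_one ne_centralBond_of_not_isB0
  dist1_expPoint_single_pi)
open Summit.QuantumFields.YangMills.BalabanUVNodes.N09TransportPositiveOnDomainOfFibredChart (betaInput_chi29_pos_iff)

variable {F : T4Continuum.T4Family} {N : ℕ} [NeZero N]

/-! ## §1 The step-0 β-input is positive at the one-defect field, whose loop at `c⋆` is far -/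

/-- Off the solvable set the step-0 critical configuration of record is the junk default `1` (`critCfgOfRecord_of_not`, `M⁰ = id`).
[cite: Balaban1987RG1, (2.3) p.265 (typing convention)] -/
theorem critCfgOfRecord_zero_of_not (ν : Stage7Numerics) {K : ℕ} {W : GaugeField (F.P K) 1 (SU N)} (h : ¬ UkExists F N K 1 ν.εreg W) (b : PBond (F.P K) 0) :
    critCfgOfRecord F N ν K 0 W b = 1 := by
  rw [critCfgOfRecord_of_not h]
  rfl

variable (K : ℕ)

/-- **`χ^{(2.9)}_0 = 1` AT THE ONE-DEFECT FIELD** `V = 1[b₀(c⋆) ↦ g]` (`c⋆ = ⟨0, e₀⟩`, `dist1 g ≥ max(δ_N, 217εreg)`, `0 < ε₁`): its average is the one-defect coarse field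
(dag-n09-w2's `avgFun_expMeanLogSU_update_one`), UNSOLVABLE (`not_ukExists_one_of_far_plaquette`), so the reference configuration is `1` and every non-distinguished
fluctuation variable is `dist1 1 = 0`. [cite: Balaban1987RG1, (2.9) p.266 and (0.21) p.256 (typing convention); Balaban1985Averaging, Prop. 1 (51) p.26] -/
theorem chiFix29OfRecord_zero_oneDefect_eq_one (hK : 1 ≤ K) (ν : Stage7Numerics) (hreg : 0 ≤ ν.εreg) (hguard : 9 * ν.εreg < deltaSU (Fin N))
    {g : SU N} (hgδ : deltaSU (Fin N) ≤ dist1 g) (hgfar : 217 * ν.εreg ≤ dist1 g) {ε₁ : ℝ} (hε : 0 < ε₁) :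
    chiFix29OfRecord F N ν ε₁ K 0 (Function.update (1 : GaugeField (F.P K) 0 (SU N)) (centralBond (⟨0, ⟨0, (F.P K).hd⟩⟩ : PBond (F.P K) 1)) g) = 1 := by
  have hj : 0 + 1 ≤ (F.P K).m + (F.P K).K := by show 1 ≤ F.m + K; omega
  have hd : 2 ≤ (F.P K).d := by show 2 ≤ 4; norm_num
  set cs : PBond (F.P K) 1 := ⟨0, ⟨0, (F.P K).hd⟩⟩ with hcs
  have havg : (avOfRecord F N K 0).avg (Function.update (1 : GaugeField (F.P K) 0 (SU N)) (centralBond cs) g) =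
      Function.update (1 : GaugeField (F.P K) 1 (SU N)) cs g := by
    rw [avOfRecord_avg]
    exact avgFun_expMeanLogSU_update_one hj hd cs hgδ
  have hns : ¬ UkExists F N K 1 ν.εreg ((avOfRecord F N K 0).avg (Function.update (1 : GaugeField (F.P K) 0 (SU N)) (centralBond cs) g)) := by
    rw [havg]
    exact not_ukExists_one_of_far_plaquette hreg hguard
      ⟨⟨cs.src, cs.dir, ⟨1, by show 1 < 4; norm_num⟩, dir_lt_one K⟩, by rw [plaqHol_update_one cs (dir_lt_one K) g]; exact hgfar⟩
  refine (chiFix29OfRecord_eq_one_iff ν ε₁ K 0 _).2 fun b hb => ?_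
  have hcrit : critCfgOfRecord F N ν K 0 ((avOfRecord F N K 0).avg (Function.update (1 : GaugeField (F.P K) 0 (SU N)) (centralBond cs) g)) b = 1 :=
    critCfgOfRecord_zero_of_not ν hns b
  have hVb : Function.update (1 : GaugeField (F.P K) 0 (SU N)) (centralBond cs) g b = 1 := by
    rw [Function.update_of_ne (ne_centralBond_of_not_isB0 hb cs)]
    rfl
  rw [fluctDevOfRecord_apply, hcrit, hVb, inv_one, mul_one, GaugeGroup.dist1_one]
  exact hε

/-- ★ **THE STEP-0 β-INPUT IS POSITIVE AT THE ONE-DEFECT FIELD** (any transport `T`, any history: `ρ_0 = χ^{(2.9)}_0·exp[…] > 0` where `χ^{(2.9)}_0 = 1`).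
[cite: Balaban1987RG1, (0.19) p.255 and (2.9) p.266] -/
theorem betaInput_chi29_zero_oneDefect_pos (hK : 1 ≤ K) (ν : Stage7Numerics) (hreg : 0 ≤ ν.εreg) (hguard : 9 * ν.εreg < deltaSU (Fin N))
    {g : SU N} (hgδ : deltaSU (Fin N) ≤ dist1 g) (hgfar : 217 * ν.εreg ≤ dist1 g) {ε₁ : ℝ} (hε : 0 < ε₁) (T : Transport F N) (gs : ℕ → ℝ) :
    0 < betaInputOfRecord F N T (chiFixed29 F N ν ε₁) K gs 0 (Function.update (1 : GaugeField (F.P K) 0 (SU N)) (centralBond (⟨0, ⟨0, (F.P K).hd⟩⟩ : PBond (F.P K) 1)) g) :=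
  (betaInput_chi29_pos_iff ν ε₁ T K gs 0 _).2 (chiFix29OfRecord_zero_oneDefect_eq_one K hK ν hreg hguard hgδ hgfar hε)

/-- **A (0.4) LOOP OF THE ONE-DEFECT FIELD AT `c⋆` IS FAR**: some non-central loop equals `g⁻¹`, at distance `dist1 g` from `1` (dag-n09-w2's
`loopHol_update_one_self_of_not_isCentral`, `exists_not_isCentral`). [cite: Balaban1987RG1, (0.4) p.253 (bookkeeping)] -/
theorem exists_loopHol_oneDefect_eq (hK : 1 ≤ K) (g : SU N) :
    ∃ i : Idx (F.P K), dist1 (loopHol (Function.update (1 : GaugeField (F.P K) 0 (SU N)) (centralBond (⟨0, ⟨0, (F.P K).hd⟩⟩ : PBond (F.P K) 1)) g)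
      (⟨0, ⟨0, (F.P K).hd⟩⟩ : PBond (F.P K) 1) i) = dist1 g := by
  have hj : 0 + 1 ≤ (F.P K).m + (F.P K).K := by show 1 ≤ F.m + K; omega
  have hd : 2 ≤ (F.P K).d := by show 2 ≤ 4; norm_num
  obtain ⟨i, hi⟩ := exists_not_isCentral hd (⟨0, ⟨0, (F.P K).hd⟩⟩ : PBond (F.P K) 1)
  exact ⟨i, by rw [loopHol_update_one_self_of_not_isCentral hj _ g hi, GaugeGroup.dist1_inv]⟩

/-! ## §2 The certificate -/

/-- ★★★ **THE GLOBAL SUPPORT∕GUARD BINDERS OF g5's DOOR ARE JOINTLY UNSATISFIABLE AT THE RECORD'S STEP-0 β-INPUT.**  For `K ≥ 1`, `0 ≤ εreg`, `9εreg < δ_N`, an element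
`g ∈ SU(N)` with `dist1 g ≥ max(δ_N, 217εreg)`, `0 < ε₁`, ANY transport `T`, ANY history and ANY `α < δ_N` (the door's own `hαδ`): NO set `K₀` of step-0 fields satisfies both
`hρK : ∀ U ∉ K₀, ρ_0 U = 0` and `hK₀α : ∀ U ∈ K₀, ∀ c i, dist1 (loopHol U c i) ≤ α` — the one-defect field is in the support of `ρ_0` (§1) but outside the loop α-guard.
So `…N09RegularOfLoopSmallChi29.regular_of_loopSmall_chi29` ∕ `domAlt_subset_regSetOfRecord_of_loopSmall_chi29` are VACUOUS at `ρ := ρ_0` of the bare-choice record; the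
LOCAL door `…N09RegularOnOfLoopSmallChi29Local` (p636180) is the one that applies. [cite: Balaban1987RG1, (0.4) p.253, (0.19) p.255, (2.9) p.266 and (0.21) p.256 (typing convention); Balaban1985Averaging, Prop. 1 (51) p.26] -/
theorem not_globalSupportGuard_betaInput_chi29_zero (hK : 1 ≤ K) (ν : Stage7Numerics) (hreg : 0 ≤ ν.εreg) (hguard : 9 * ν.εreg < deltaSU (Fin N))
    {g : SU N} (hgδ : deltaSU (Fin N) ≤ dist1 g) (hgfar : 217 * ν.εreg ≤ dist1 g) {ε₁ : ℝ} (hε : 0 < ε₁) (T : Transport F N) (gs : ℕ → ℝ)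
    {α : ℝ} (hαδ : α < deltaSU (Fin N)) (K₀ : Set (GaugeField (F.P K) 0 (SU N))) :
    ¬ ((∀ U, U ∉ K₀ → betaInputOfRecord F N T (chiFixed29 F N ν ε₁) K gs 0 U = 0) ∧
        (∀ U ∈ K₀, ∀ c (i : Idx (F.P K)), dist1 (loopHol U c i) ≤ α)) := by
  rintro ⟨hρK, hK₀α⟩
  have hpos := betaInput_chi29_zero_oneDefect_pos K hK ν hreg hguard hgδ hgfar hε T gs
  have hmem : Function.update (1 : GaugeField (F.P K) 0 (SU N)) (centralBond (⟨0, ⟨0, (F.P K).hd⟩⟩ : PBond (F.P K) 1)) g ∈ K₀ := by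
    by_contra h
    exact absurd (hρK _ h) hpos.ne'
  obtain ⟨i, hi⟩ := exists_loopHol_oneDefect_eq (N := N) K hK g
  have h := hK₀α _ hmem (⟨0, ⟨0, (F.P K).hd⟩⟩ : PBond (F.P K) 1) i
  have h' : dist1 g ≤ α := by rw [← hi]; exact h
  exact absurd (hgδ.trans h') (not_le.2 hαδ)

/-- ★★ **`SU(2)`, PRINT's REGIME**: with `g = exp(π e₀)` (`dist1 g = 2`, dag-n09-w2's `dist1_expPoint_single_pi`; `δ_{SU(2)} = 1∕3`), for `0 ≤ εreg`, `217·εreg ≤ 2`, `0 < ε₁`,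
`K ≥ 1`, any transport, any history, any `α < δ_{SU(2)}` and any `K₀`: the global support∕guard binders fail at the record's step-0 β-input.
[cite: Balaban1987RG1, (0.4) p.253, (0.19) p.255, (2.9) p.266; Balaban1985Averaging, Prop. 1 (51) p.26] -/
theorem not_globalSupportGuard_betaInput_chi29_zero_SU2 {F : T4Continuum.T4Family} (K : ℕ) (hK : 1 ≤ K) (ν : Stage7Numerics) (hreg : 0 ≤ ν.εreg)
    (hreg' : 217 * ν.εreg ≤ 2) {ε₁ : ℝ} (hε : 0 < ε₁) (T : Transport F 2) (gs : ℕ → ℝ) {α : ℝ} (hαδ : α < deltaSU (Fin 2))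
    (K₀ : Set (GaugeField (F.P K) 0 (SU 2))) :
    ¬ ((∀ U, U ∉ K₀ → betaInputOfRecord F 2 T (chiFixed29 F 2 ν ε₁) K gs 0 U = 0) ∧
        (∀ U ∈ K₀, ∀ c (i : Idx (F.P K)), dist1 (loopHol U c i) ≤ α)) := by
  have h2 := dist1_expPoint_single_pi
  have hδ : deltaSU (Fin 2) = 1 / 3 := by
    rw [deltaSU, Fintype.card_fin, min_eq_left]
    have := Real.pi_gt_three
    push_cast
    linarith
  refine not_globalSupportGuard_betaInput_chi29_zero K hK ν hreg ?_ (g := T4HaarSU2ExpChart.expPoint (EuclideanSpace.single (0 : Fin 3) Real.pi)) ?_ ?_ hε T gs hαδ K₀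
  · rw [hδ]; linarith
  · rw [hδ, h2]; norm_num
  · rw [h2]; exact hreg'

end Summit.QuantumFields.YangMills.BalabanUVNodes.N09GlobalRoadBBindersJunkLocated

end
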